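import Summits.QuantumFields.BalabanUV.Beta.GAN24.CombContactKernelCells
import Summits.QuantumFields.BalabanUV.Beta.GAN24.CombContactGaugeStaircase
import Summits.QuantumFields.BalabanUV.Beta.GAN24.ContactCellLetters

/-!
# `BalabanUV.Beta.GAN24.CombContactCellLetters` — binder row G-an2-4 ∕ (CONV-C), TRANSFER-III, the (III′) S-slot (b) of the END `CombChargeRowsClosed`, the (III′) WILSON
# CONTACT END `hCT′` (M.104's first hypothesis), part 2: **THE (III′) LETTERS IN THE SHAPES THE CELLS EAT** — the (III′) twin of MY g58 (E) `ContactCellLetters`: the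
# conjugated composite leg OPENED in the B6 spelling (`T′ μ z κ u = B μ z κ u + (λ′(u + e_κ) − λ′ u)`, road-P2's M.59 `combLegChain_apply_eq_add_dz`), its fibres
# summable (the OWNER's `exists_legL1_legChain_psiLeg`), and its Maxwell operator = the translated tent force of the undressed leg (the OWNER's
# `curv_legAct_legChain_psiLeg`: `curv ∘ dz = 0` kills BOTH pure gauges) — so every gauge-blind letter of the (E) cells transfers VERBATIM.

NOT IN PRINT; OUR BOOKKEEPING (G-an2-4 formalisation swarm, leaf prover `b2b-balaban-gan24-formalise-leaf-01`, gen 89; [folklore] bookkeeping BY NAME over road-P2's M.59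
`CombContactKernelCells`, the OWNER gan24-p1's `CombLegChainGauge`, MY (E) `ContactCellLetters ∕ ContactKernelCells`; 0 `def`, 0 cited facts, 0 `def … : Prop`, 0 sorry).
HONEST FRAMING (cell contract, verbatim): «discharging `BetaPertH` makes Bałaban's UV stability UNCONDITIONAL — a real constructive-QFT result; it is NOT the continuum
limit and NOT the Clay problem.»  HONEST DEPENDENCY (verbatim): «continuum YM on T⁴ ⇐ BetaPertH ∧ nine spine estimates (0/9 proved); BetaPertH ⇐ (D1) ∧ (D4) ∧ CAP+tail;
G-an2-4 gates asym, D1 and NE2/3/4.»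

WHAT (generic `d` unless said; in-block roots `r` (of `Ψ̂_S`) and `rr` (of the dressing), `ρ = toSite rr`; `T′ = legChain (j ↦ legComp ψ♭ (respStepBmSeq ρ Lc j)) m k`,
`ψ♭ α x κ u = psiKS r Lc u x (inl κ) (inl α)`, `B = respStep (Lc^m) (Lc^(m+k+1))`, `λ′ μ z = Psi ρ Lc m k (delta1 μ z) + PsiFace r ρ Lc m k (delta1 μ z) − bmGaugeAt ρ (B μ z) Lc`):
* `combLegChain_apply_eq` (`T′ μ z κ u = B μ z κ u + (λ′ μ z (u + e_κ) − λ′ μ z u)`), `summable_combLegChain` (every fibre `u ↦ T′ μ z κ u` summable),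
  `curvAdj_curv_combLegChain_eq` (`d*d (T′ μ z) = d*d (B μ z)`), and at `d = 3`, `m = 0`: `curvAdj_curv_combLegChain_zero_eq_contourSumAdj` (`d*d (T′ μ z) = 𝒬ᵀ_N φ_{μ,z}`,
  `φ_{μ,z} κ y = wΦ κ μ (y − z)`, `N = Lc^{k+1}` — MY (E) `curvAdj_curv_respStep_zero_eq_contourSumAdj` behind it).
NO estimate; discharges NOTHING of (hS, hSall); NEVER «G-an2-4 closed» as (CONV-C); NOT D1, NOT BetaPertH, NOT continuum, NOT Clay.  2026-08-28; no existing file touched.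
-/

noncomputable section

open Finset
open scoped BigOperators
open Literature.MathematicalPhysics.QuantumFieldTheory
open Literature.MathematicalPhysics.QuantumFieldTheory.LatticeForm (quo)
open Literature.MathematicalPhysics.QuantumFieldTheory.Balaban1983to89
open Literature.MathematicalPhysics.QuantumFieldTheory.Balaban1983to89.Beta
open B4ContourShift (supNorm)
open AffineAveraging (Form0 Form1 Site box toSite curv curvAdj dz)
open AffineReproduction (contourSumAdj)
open KernelSpecInstance (wΦ)
open B6BondElimination (unitVec)
open KKTFluctuationKernel (delta1)
open BalabanCompositeJets (respStep)
open Summit.QuantumFields.BalabanUV.Beta.AxialProjectorBlockMean (bmGaugeAt)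
open Summit.QuantumFields.BalabanUV.Beta.SymCorrectorKernel (psiKS)
open Summit.QuantumFields.BalabanUV.Beta.GAN24.Push4 (legComp)
open Summit.QuantumFields.BalabanUV.Beta.GAN24.Push4Iter (LegFam legChain)
open Summit.QuantumFields.BalabanUV.Beta.GAN24.RespStepBmDecompLegs (legAct LegL1)
open Summit.QuantumFields.BalabanUV.Beta.GAN24.RespStepBmDecompExact (respStepBmSeq)
open Summit.QuantumFields.BalabanUV.Beta.GAN24.RespStepBmDecompPsi (Psi)
open Summit.QuantumFields.BalabanUV.Beta.GAN24.ContactOneGaugeCellAlgebra (dz_apply')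
open Summit.QuantumFields.BalabanUV.Beta.GAN24.ContactKernelCells (summable_delta1 legAct_delta1_eq)
open Summit.QuantumFields.BalabanUV.Beta.GAN24.ContactCellLetters (curvAdj_curv_respStep_zero_eq_contourSumAdj)
open Summit.QuantumFields.BalabanUV.Beta.GAN24.CombLegChainGauge (PsiFace exists_legL1_legChain_psiLeg curv_legAct_legChain_psiLeg)
open Summit.QuantumFields.BalabanUV.Beta.GAN24.CombContactKernelCells (combLegChain_apply_eq_add_dz)

namespace Summit.QuantumFields.BalabanUV.Beta.GAN24.CombContactCellLetters

variable {d : ℕ} {Lc : ℕ} [NeZero Lc]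

/-! ## §1 The conjugated composite leg opened, summable, with the Maxwell operator of the undressed leg (generic `d`) -/

section Generic

variable {r : Fin (d + 1) → ℕ} (hr : r ∈ box (d + 1) Lc) {rr : Fin (d + 1) → ℕ} (hrr : rr ∈ box (d + 1) Lc)
include hr hrr

/-- [folklore] **THE CONJUGATED COMPOSITE LEG OPENED, B6 spelling**: `T′ μ z κ u = B μ z κ u + (λ′ μ z (u + e_κ) − λ′ μ z u)` (road-P2's M.59
`combLegChain_apply_eq_add_dz` + leaf-02's `dz_apply'`) — the hypothesis `hT₁ ∕ hT₃` of MY (E) `ContactCellReduction.abs_cellL_le_pieces ∕ abs_cellR_le_pieces`. -/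
theorem combLegChain_apply_eq (m k : ℕ) (μ : Fin (d + 1)) (z : Site (d + 1)) (κ : Fin (d + 1)) (u : Site (d + 1)) :
    legChain (fun j => legComp (fun α x κ u => psiKS r Lc u x (Sum.inl κ) (Sum.inl α)) (respStepBmSeq (d := d) (toSite rr) Lc j)) m k μ z κ u
      = respStep (d := d) (Lc ^ m) (Lc ^ (m + k + 1)) μ z κ u
        + ((Psi (toSite rr) Lc m k (delta1 μ z) + PsiFace r (toSite rr) Lc m k (delta1 μ z)
              - bmGaugeAt (toSite rr) (respStep (d := d) (Lc ^ m) (Lc ^ (m + k + 1)) μ z) Lc) (u + unitVec κ)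
          - (Psi (toSite rr) Lc m k (delta1 μ z) + PsiFace r (toSite rr) Lc m k (delta1 μ z)
              - bmGaugeAt (toSite rr) (respStep (d := d) (Lc ^ m) (Lc ^ (m + k + 1)) μ z) Lc) u) := by
  rw [combLegChain_apply_eq_add_dz hr hrr m k μ z κ u, dz_apply']

/-- [folklore] **EVERY FIBRE OF THE CONJUGATED COMPOSITE LEG IS SUMMABLE** (the OWNER's `exists_legL1_legChain_psiLeg`: `LegL1` carries fibrewise summability) — the
hypothesis `hT₃s` of MY (E) `abs_cellL_le_pieces`; no envelope and no `2 ≤ Lc` needed. -/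
theorem summable_combLegChain (m k : ℕ) (μ : Fin (d + 1)) (z : Site (d + 1)) (κ : Fin (d + 1)) :
    Summable (legChain (fun j => legComp (fun α x κ u => psiKS r Lc u x (Sum.inl κ) (Sum.inl α)) (respStepBmSeq (d := d) (toSite rr) Lc j)) m k μ z κ) := by
  obtain ⟨C, T, hT⟩ := exists_legL1_legChain_psiLeg (d := d) hr hrr m k
  exact (hT.2 μ z κ).1

/-- NOT IN PRINT; OUR BOOKKEEPING.  **THE MAXWELL OPERATOR OF THE CONJUGATED COMPOSITE LEG IS THAT OF THE UNDRESSED MEMBER** (every `m k`, as 1-forms in the output bond):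
`curvAdj (curv (T′ μ z)) = curvAdj (curv (B μ z))` — the OWNER's `curv_legAct_legChain_psiLeg` (`curv ∘ dz = 0` for BOTH the inter-block gauge `Ψ` and the face gauge `PsiFace`)
at the point datum `delta1 μ z` (`legAct_delta1_eq`). -/
theorem curvAdj_curv_combLegChain_eq (m k : ℕ) (μ : Fin (d + 1)) (z : Site (d + 1)) :
    curvAdj (curv (legChain (fun j => legComp (fun α x κ u => psiKS r Lc u x (Sum.inl κ) (Sum.inl α)) (respStepBmSeq (d := d) (toSite rr) Lc j)) m k μ z))
      = curvAdj (curv (respStep (d := d) (Lc ^ m) (Lc ^ (m + k + 1)) μ z)) := by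
  have h := curv_legAct_legChain_psiLeg hr hrr m k (summable_delta1 μ z)
  rw [legAct_delta1_eq, legAct_delta1_eq] at h
  rw [h]

end Generic

/-! ## §2 `d = 3`, `m = 0`: the Maxwell operator of the conjugated leg is the translated tent force -/

section Four

variable {r : Fin (3 + 1) → ℕ} (hr : r ∈ box (3 + 1) Lc) {rr : Fin (3 + 1) → ℕ} (hrr : rr ∈ box (3 + 1) Lc)
include hr hrr

/-- NOT IN PRINT; OUR BOOKKEEPING.  **THE MAXWELL OPERATOR OF THE CONJUGATED COMPOSITE LEG AT `m = 0` IS THE TRANSLATED TENT FORCE**: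
`curvAdj (curv (T′ μ z)) = contourSumAdj (Lc^(k+1)) φ_{μ,z}`, `φ_{μ,z} κ y = wΦ κ μ (y − z)` (§1 + MY (E) `curvAdj_curv_respStep_zero_eq_contourSumAdj`) — the hypothesis `hM₁ ∕ hM₃`
of MY (E) cell reductions, for the (III′) legs. -/
theorem curvAdj_curv_combLegChain_zero_eq_contourSumAdj (k : ℕ) (μ : Fin (3 + 1)) (z : Site (3 + 1)) :
    curvAdj (curv (legChain (fun j => legComp (fun α x κ u => psiKS r Lc u x (Sum.inl κ) (Sum.inl α)) (respStepBmSeq (d := 3) (toSite rr) Lc j)) 0 k μ z))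
      = contourSumAdj (Lc ^ (k + 1)) (fun κ y => wΦ (N := Lc ^ (k + 1)) κ μ (y - z)) := by
  rw [curvAdj_curv_combLegChain_eq hr hrr 0 k μ z, curvAdj_curv_respStep_zero_eq_contourSumAdj]

end Four

end Summit.QuantumFields.BalabanUV.Beta.GAN24.CombContactCellLetters

end
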